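import Summits.AtomisticToContinuum.HydrodynamicLimit.Theorems.OneFlightGossipEngineKineticCurrentsWindowLDUniformClassTruncationReduced

/-!
# Truncation of the kinetic-currents class with radial re-orthogonalisation
# (stub `stub_classTruncation` of line `Sketch` for the crux `KineticCurrentsWindowLDUniform`,
# stmt-AtomisticToContinuum-14662)

File C (assembly) for the registered stub `stub_classTruncation` (S3) of the line skeleton
`Cruxes/KineticCurrentsWindowLDUniform/Lines/Sketch.lean` (static Gaussian analysis, no dynamics);
helper files A `…ClassTruncationGauss.lean` (Gaussian moment algebra) and B
`…ClassTruncationReduced.lean` (the class in the reduced variable `v = u₀(x) + √θ₀(x) ξ`).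

An admissible crux functional `F(x,v) = A(x):(w⊗w) + (b(x)·w) G(x,|w|²)`, `w = v − u₀(x)`, of
quadratic growth `|F| ≤ C(1+|v|²)` and orthogonal to `1, v_j, |v|²` under the local Maxwellian
`M_x = M_{1,u₀(x),θ₀(x)}` at every `x`, is split as `F = F' + R` with, for a truncation level `L`,

* `F' = χ_L(|w|²)·F − ρ_L(x) (b(x)·w) (1 + |w|²/θ₀(x))⁻¹`, i.e. the class member with radial weights
  `H' = χ_L`, `G' = G χ_L − ρ_L(x)(1 + |s|/θ₀(x))⁻¹` (`χ_L(s) = min 1 (max 0 (2 − s/L))`); it is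
  bounded, of growth `≤ C₁(1+|v|²)` with `C₁` independent of `L`, and orthogonal to `1, v_j, |v|²`:
  the `A`-part because `tr A(x) = 0` (forced by `F ⊥ 1`: `∫ F M_x = θ₀ tr A`) and Gaussian
  coordinate symmetry, the `b`-part because it is odd and `ρ_L(x) = R_L(x)/m₀` is chosen so that its
  `ξ_j`-moments `√θ b_j (R_L − ρ_L m₀)` vanish (`R_L(x) = E[ξ_0² Gχ_L]`, continuous in `x` by dominated
  convergence, `m₀ = E[ξ_0²(1+|ξ|²)⁻¹] > 0`);
* `|R| ≤ Y_L := C(1+|v|²)(1 − χ_L(|w|²)) + δ_L`, where `δ_L = O(1/L)` bounds the correction because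
  `√θ b_j R_L = −∫ F (1−χ_L) ξ_j dγ` is a Gaussian tail (this is where `F ⊥ v_j` is used), and
  `∫ e^{κ₀ Y_L} M_x ≤ e^{κ₀δ_L}(1 + O(1/L)) ≤ e^{η}` for `L` large, uniformly in `x`, by convexity of
  `exp`, `1 − χ_L(s) ≤ s/L` and Fernique's theorem (`κ₀ = a/(K+1)` depends only on
  `C, sup θ₀, sup |u₀|` and Fernique's constant `2a` of `γ`).

No new definitions: `χ`, `ρ`, `F'`, `Y` are local terms of the proof. The hypothesis `F ⊥ ‖v‖²` is
not used (it is implied by the other two, refuter cdisprove-14662 § 2).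
-/

noncomputable section

open MeasureTheory Set Filter
open scoped ENNReal Topology

namespace Summit.AtomisticToContinuum.HydrodynamicLimit.Theorems.KineticCurrentsWindowLDUniformSketch

open Literature.Analysis.FluidPDE (HardSphereFlow Config localMaxwellian)
open Literature.MathematicalPhysics.KineticTheory (T3 V3 hsDiameter localGibbsLaw localGibbsMeasure)
open Literature.MathematicalPhysics.KineticTheory (integral_coord_sq_stdGaussian
  exists_forall_abs_le_of_continuous)
open ProbabilityTheory
open ClassTruncation

-- one 320-line assembly proof (about 15 `set` constants and 40 intermediate facts) needs slightly
-- more than the default 200000 heartbeats (it elaborates with 300000); 400000 leaves a margin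
set_option maxHeartbeats 400000 in
/-- **S3 — truncation of the class with radial re-orthogonalisation** (registered stub
`stub_classTruncation` of line `Sketch`, crux stmt-AtomisticToContinuum-14662). An admissible crux
functional `F = A(x):(w⊗w) + (b·w)G(x,|w|²)` (`w = v − u₀(x)`; growth `C`; `⊥ 1, v_j, ‖v‖²` under
`M_{1,u₀(x),θ₀(x)}` at every `x`) splits, for every `η > 0`, as `F = F' + R` with
`F' = H'(x,|w|²)·A:(w⊗w) + (b·w)G'(x,|w|²)` (`H', G'` continuous), BOUNDED, of growth
`≤ C₁(1+‖v‖²)` with `C₁` independent of `η`, still orthogonal, and `|R| ≤ Y`, `Y ≥ 0` continuous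
with `∫ e^{κ₀ Y(x,v)} M_x(v) dv ≤ e^{η}` at every `x` (`κ₀ > 0` independent of `η`). Construction:
`H' = χ_L`, `G' = Gχ_L − ρ_L(x)(1 + |s|/θ₀(x))⁻¹` with `χ_L(s) = min 1 (max 0 (2 − s/L))` and
`ρ_L = R_L/m₀` (module docstring); `tr A = 0` from `F ⊥ 1`, the size of `ρ_L b` from `F ⊥ v_j`
(`tail_first_moment`), orthogonality of `F'` by `truncated_gauss_orth`, the exponential moment by
`exp_tail_bound` and Fernique; `L` large depending on `η`. [folklore] -/
theorem stub_classTruncation :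
    ∀ (θ₀ : T3 → ℝ) (u₀ : T3 → V3), Continuous θ₀ → Continuous u₀ → (∀ x, 0 < θ₀ x) →
      ∀ (A : T3 → Fin 3 → Fin 3 → ℝ) (b : T3 → V3) (G : T3 × ℝ → ℝ),
      Continuous A → Continuous b → Continuous G →
      ∀ (F : T3 × V3 → ℝ), (∀ y, F y =
        (∑ j : Fin 3, ∑ k : Fin 3, A y.1 j k * ((y.2 - u₀ y.1) j * (y.2 - u₀ y.1) k)) +
          (∑ j : Fin 3, b y.1 j * (y.2 - u₀ y.1) j) * G (y.1, ‖y.2 - u₀ y.1‖ ^ 2)) →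
      ∀ C : ℝ, (∀ y, |F y| ≤ C * (1 + ‖y.2‖ ^ 2)) →
      (∀ x, ∫ v, F (x, v) * localMaxwellian 1 (θ₀ x) (u₀ x) v = 0) →
      (∀ x (j : Fin 3), ∫ v, F (x, v) * v j * localMaxwellian 1 (θ₀ x) (u₀ x) v = 0) →
      (∀ x, ∫ v, F (x, v) * ‖v‖ ^ 2 * localMaxwellian 1 (θ₀ x) (u₀ x) v = 0) →
      ∃ C₁ : ℝ, 0 ≤ C₁ ∧ ∃ κ₀ : ℝ, 0 < κ₀ ∧ ∀ η : ℝ, 0 < η →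
        ∃ (H' G' : T3 × ℝ → ℝ), Continuous H' ∧ Continuous G' ∧
        ∃ (F' Y : T3 × V3 → ℝ), (∀ y, F' y =
          H' (y.1, ‖y.2 - u₀ y.1‖ ^ 2) *
              (∑ j : Fin 3, ∑ k : Fin 3, A y.1 j k * ((y.2 - u₀ y.1) j * (y.2 - u₀ y.1) k)) +
            (∑ j : Fin 3, b y.1 j * (y.2 - u₀ y.1) j) * G' (y.1, ‖y.2 - u₀ y.1‖ ^ 2)) ∧
          Continuous Y ∧ (∀ y, 0 ≤ Y y) ∧
          (∃ B : ℝ, ∀ y, |F' y| ≤ B) ∧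
          (∀ y, |F' y| ≤ C₁ * (1 + ‖y.2‖ ^ 2)) ∧
          (∀ x, ∫ v, F' (x, v) * localMaxwellian 1 (θ₀ x) (u₀ x) v = 0) ∧
          (∀ x (j : Fin 3), ∫ v, F' (x, v) * v j * localMaxwellian 1 (θ₀ x) (u₀ x) v = 0) ∧
          (∀ x, ∫ v, F' (x, v) * ‖v‖ ^ 2 * localMaxwellian 1 (θ₀ x) (u₀ x) v = 0) ∧
          (∀ y, |F y - F' y| ≤ Y y) ∧
          (∀ x, ∫⁻ v, ENNReal.ofReal (Real.exp (κ₀ * Y (x, v)) * localMaxwellian 1 (θ₀ x) (u₀ x) v)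
            ≤ ENNReal.ofReal (Real.exp η)) := by
  intro θ₀ u₀ hθc huc hθpos A b G hAc hbc hGc F hF C hC h1 hv _h2
  /- Step 0: global constants from the compactness of `𝕋³`. -/
  obtain ⟨θM, -, hθM'⟩ := exists_forall_abs_le_of_continuous hθc
  have hθM : ∀ x, θ₀ x ≤ θM := fun x => (le_abs_self _).trans (hθM' x)
  have hθM0 : 0 < θM := (hθpos 0).trans_le (hθM 0)
  obtain ⟨U, hU0, hU'⟩ := exists_forall_abs_le_of_continuous (continuous_norm.comp huc)
  have hU : ∀ x, ‖u₀ x‖ ≤ U := fun x => (le_abs_self _).trans (hU' x)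
  have hC0 : 0 ≤ C := by
    have h := (abs_nonneg _).trans (hC ((0 : T3), (0 : V3))); norm_num at h; exact h
  set K : ℝ := C * (1 + 2 * U ^ 2 + 2 * θM) with hK
  have hK0 : 0 ≤ K := by positivity
  have hCK : ∀ x (ξ : V3), C * (1 + ‖u₀ x + Real.sqrt (θ₀ x) • ξ‖ ^ 2) ≤ K * (1 + ‖ξ‖ ^ 2) := by
    intro x ξ
    have hn := norm_shift_sq_le (hθpos x).le (u₀ x) ξ
    have h2 : θ₀ x * ‖ξ‖ ^ 2 ≤ θM * ‖ξ‖ ^ 2 := mul_le_mul_of_nonneg_right (hθM x) (sq_nonneg _)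
    have h3 : ‖u₀ x‖ ^ 2 ≤ U ^ 2 := pow_le_pow_left₀ (norm_nonneg _) (hU x) 2
    rw [hK, mul_assoc]
    refine mul_le_mul_of_nonneg_left ?_ hC0
    nlinarith [sq_nonneg ‖ξ‖, mul_nonneg (sq_nonneg U) (sq_nonneg ‖ξ‖), hθM0.le, sq_nonneg U]
  have hFK : ∀ x (ξ : V3), |F (x, u₀ x + Real.sqrt (θ₀ x) • ξ)| ≤ K * (1 + ‖ξ‖ ^ 2) :=
    fun x ξ => (hC _).trans (hCK x ξ)
  -- Fernique's constant and the moment constants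
  obtain ⟨a, ha, hexp⟩ : ∃ a : ℝ, 0 < a ∧
      Integrable (fun ξ : V3 => Real.exp (2 * a * ‖ξ‖ ^ 2)) (stdGaussian V3) := by
    obtain ⟨c, hc, hi⟩ := IsGaussian.exists_integrable_exp_sq (stdGaussian V3)
    refine ⟨c / 2, by positivity, ?_⟩
    have e : 2 * (c / 2) = c := by ring
    simpa only [e] using hi
  set I₆ : ℝ := ∫ ξ, (1 + ‖ξ‖ ^ 2) ^ 3 ∂stdGaussian V3 with hI₆
  have hI₆0 : 0 ≤ I₆ := integral_nonneg fun ξ => by positivity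
  set IF : ℝ := ∫ ξ, Real.exp (2 * a * ‖ξ‖ ^ 2) ∂stdGaussian V3 with hIF
  have hIF0 : 0 ≤ IF := integral_nonneg fun ξ => (Real.exp_pos _).le
  set m₀ : ℝ := ∫ ξ, ξ 0 * ξ 0 * (1 + |‖ξ‖ ^ 2|)⁻¹ ∂stdGaussian V3 with hm₀def
  have hm₀ : 0 < m₀ := refMoment_pos
  clear_value I₆ IF m₀
  /- Step 1: reduced orthogonality of `F` and `tr A = 0`. -/
  have hFc : Continuous F := by
    rw [show F = _ from funext hF]; fun_prop
  have hFred : ∀ x, (∫ ξ, F (x, u₀ x + Real.sqrt (θ₀ x) • ξ) ∂stdGaussian V3 = 0) ∧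
      ∀ j, ∫ ξ, F (x, u₀ x + Real.sqrt (θ₀ x) • ξ) * ξ j ∂stdGaussian V3 = 0 := fun x =>
    gauss_orth_of_maxwellian_orth (Φ := fun v => F (x, v)) (by fun_prop) (hθpos x) (u₀ x)
      (hFK x) (h1 x) (hv x)
  have hFsh : ∀ x (ξ : V3), F (x, u₀ x + Real.sqrt (θ₀ x) • ξ) =
      θ₀ x * (∑ j, ∑ k, A x j k * (ξ j * ξ k)) * 1 +
        Real.sqrt (θ₀ x) * (∑ j, b x j * ξ j) * G (x, θ₀ x * ‖ξ‖ ^ 2) := by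
    intro x ξ
    rw [hF]
    have h := classForm_shift (Real.mul_self_sqrt (hθpos x).le) (u₀ x) (A x) (b x)
      (fun _ => (1 : ℝ)) (fun s => G (x, s)) ξ
    rw [one_mul] at h; exact h
  have htr : ∀ x, ∑ j, A x j j = 0 := by
    intro x
    obtain ⟨hi0, -, -⟩ := integrable_of_le_lin (h := fun ξ => F (x, u₀ x + Real.sqrt (θ₀ x) • ξ))
      (by fun_prop) (hFK x)
    have h : ∫ ξ : V3, F (x, u₀ x + Real.sqrt (θ₀ x) • ξ) * 1 ∂stdGaussian V3 =
        θ₀ x * (∑ j, A x j j) * ∫ ξ : V3, ξ 0 * ξ 0 * (1 * 1) ∂stdGaussian V3 :=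
      integral_classForm_mul_even (κ := fun _ => (1 : ℝ)) (ϖ := fun _ => (1 : ℝ))
        (lam := fun s => G (x, θ₀ x * s)) (hFsh x) continuous_const (P := 1)
        (fun s hs => by rw [mul_one, abs_one]; linarith) (by simpa using hi0)
    have h1' : ∫ ξ : V3, ξ 0 * ξ 0 ∂stdGaussian V3 = 1 := by
      simpa [sq] using integral_coord_sq_stdGaussian (ι := Fin 3) 0
    simp only [mul_one, (hFred x).1, h1'] at h
    exact (mul_eq_zero.1 h.symm).resolve_left (hθpos x).ne'
  /- Step 2: the constants `C₁`, `κ₀`; the truncation level `L` for a given `η`. -/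
  refine ⟨C + 3 * (K * θM * I₆) / m₀, by positivity, a / (K + 1), by positivity, fun η hη => ?_⟩
  set Q₁ : ℝ := θM * (Real.exp a / a) * IF with hQ₁
  set Q₂ : ℝ := a / (K + 1) * (3 * (K * θM * I₆ / m₀)) with hQ₂
  have hQ₁0 : 0 ≤ Q₁ := by positivity
  have hQ₂0 : 0 ≤ Q₂ := by positivity
  set L : ℝ := max 1 (max (2 * Q₁ / η) (2 * Q₂ / η)) with hL
  have hL1 : 1 ≤ L := le_max_left _ _
  have hL0 : 0 < L := one_pos.trans_le hL1
  have hQ₁L : Q₁ / L ≤ η / 2 := by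
    rw [div_le_iff₀ hL0]
    have : 2 * Q₁ / η ≤ L := (le_max_left _ _).trans (le_max_right _ _)
    rw [div_le_iff₀ hη] at this; linarith
  have hQ₂L : Q₂ / L ≤ η / 2 := by
    rw [div_le_iff₀ hL0]
    have : 2 * Q₂ / η ≤ L := (le_max_right _ _).trans (le_max_right _ _)
    rw [div_le_iff₀ hη] at this; linarith
  -- the cutoff `χ(s) = min 1 (max 0 (2 - s/L))`: `= 1` on `s ≤ L`, `= 0` on `s ≥ 2L`
  set χ : ℝ → ℝ := fun s => min 1 (max 0 (2 - s / L)) with hχ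
  obtain ⟨hχc, hχ0, hχ1, hχhi, hχtail⟩ := cutoff_props hL0 (χ := χ) fun s => by rw [hχ]
  clear_value χ
  -- `G` is bounded on `𝕋³ × [0, 2L]`, so the truncated radial weight `Gχ` is bounded
  obtain ⟨GM, hGM⟩ : ∃ GM : ℝ, ∀ x s, 0 ≤ s → s ≤ 2 * L → |G (x, s)| ≤ GM := by
    obtain ⟨GM, hGM⟩ := (isCompact_univ.prod (isCompact_Icc (a := (0 : ℝ)) (b := 2 * L)))
      |>.exists_bound_of_continuousOn hGc.continuousOn
    exact ⟨GM, fun x s h0 h1 => by simpa using hGM (x, s) ⟨mem_univ _, h0, h1⟩⟩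
  have hGM0 : 0 ≤ GM := (abs_nonneg _).trans (hGM 0 0 le_rfl (by positivity))
  have hGχ : ∀ x s, 0 ≤ s → |G (x, s) * χ s| ≤ GM := by
    intro x s hs
    by_cases h : s ≤ 2 * L
    · rw [abs_mul, abs_of_nonneg (hχ0 s)]
      exact (mul_le_mul (hGM x s hs h) (hχ1 s) (hχ0 s) hGM0).trans (le_of_eq (mul_one _))
    · rw [hχhi s (not_le.1 h).le, mul_zero, abs_zero]; exact hGM0
  /- Step 3: the re-orthogonalisation coefficient `ρ = R/m₀` (continuous in `x`) and its size. -/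
  set R : T3 → ℝ := fun x => ∫ ξ, ξ 0 * ξ 0 * (G (x, θ₀ x * ‖ξ‖ ^ 2) * χ (θ₀ x * ‖ξ‖ ^ 2))
    ∂stdGaussian V3 with hR
  have hRc : Continuous R := by
    refine continuous_of_dominated (bound := fun ξ : V3 => 1 * 1 * GM * (1 + ‖ξ‖ ^ 2) ^ 3)
      (fun x => (by fun_prop : Continuous fun ξ : V3 => ξ 0 * ξ 0 *
        (G (x, θ₀ x * ‖ξ‖ ^ 2) * χ (θ₀ x * ‖ξ‖ ^ 2))).aestronglyMeasurable)
      (fun x => ae_of_all _ fun ξ => ?_) (integrable_one_add_norm_sq_cube.const_mul _)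
      (ae_of_all _ fun ξ => by fun_prop)
    rw [Real.norm_eq_abs]
    exact abs_mul_three_le (abs_coord_le' ξ 0) (abs_coord_le' ξ 0)
      (le_mul_one_add (hGχ x _ (mul_nonneg (hθpos x).le (sq_nonneg _))) hGM0 (sq_nonneg _))
  set ρ : T3 → ℝ := fun x => R x / m₀ with hρ
  have hρc : Continuous ρ := by rw [hρ]; exact hRc.div_const _
  clear_value R ρ
  set e : ℝ := K * θM * I₆ / L with he
  have he0 : 0 ≤ e := by positivity
  have hbR : ∀ x j, |Real.sqrt (θ₀ x) * b x j * R x| ≤ e := by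
    intro x j
    have h := tail_first_moment (χ := fun s => χ (θ₀ x * s)) (g := fun s => G (x, θ₀ x * s))
      (by fun_prop) (fun s => hχ0 _) (fun s => hχ1 _) (m := 1 / L * θ₀ x)
      (mul_nonneg (by positivity) (hθpos x).le)
      (fun s hs => by
        have := hχtail (θ₀ x * s) (mul_nonneg (hθpos x).le hs)
        rwa [← mul_assoc] at this)
      (by fun_prop) (Q := GM) (fun s hs => hGχ x _ (mul_nonneg (hθpos x).le hs))
      (f := fun ξ => F (x, u₀ x + Real.sqrt (θ₀ x) • ξ)) (by fun_prop) (hFK x) (hFsh x) j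
      ((hFred x).2 j)
    rw [← hI₆, show (∫ ξ : V3, ξ 0 * ξ 0 * (G (x, θ₀ x * ‖ξ‖ ^ 2) * χ (θ₀ x * ‖ξ‖ ^ 2))
      ∂stdGaussian V3) = R x from by rw [hR]] at h
    refine h.trans ?_
    rw [he]
    calc 1 / L * θ₀ x * K * I₆ ≤ 1 / L * θM * K * I₆ := by gcongr; exact hθM x
      _ = K * θM * I₆ / L := by ring
  set δ : ℝ := 3 * (e / m₀) with hδ
  have hδ0 : 0 ≤ δ := by positivity
  have hcorr : ∀ x (w : V3),
      |ρ x * (∑ j, b x j * w j) * (1 + |‖w‖ ^ 2| / θ₀ x)⁻¹| ≤ δ := fun x w => by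
    rw [hρ, hδ]; exact corr_bound (hθpos x) hm₀ (hbR x) w
  /- Step 4: the truncated functional `F'`, the remainder bound `Y`. -/
  set H' : T3 × ℝ → ℝ := fun p => χ p.2 with hH'
  set G' : T3 × ℝ → ℝ := fun p => G p * χ p.2 - ρ p.1 * (1 + |p.2| / θ₀ p.1)⁻¹ with hG'
  have hH'c : Continuous H' := hχc.comp continuous_snd
  have hG'c : Continuous G' := by
    have h1 : Continuous fun p : T3 × ℝ => (1 + |p.2| / θ₀ p.1)⁻¹ :=
      (continuous_const.add ((continuous_abs.comp continuous_snd).div (hθc.comp continuous_fst)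
        fun p => (hθpos p.1).ne')).inv₀ fun p =>
          (by have := hθpos p.1; positivity : (0 : ℝ) < 1 + |p.2| / θ₀ p.1).ne'
    exact (hGc.mul (hχc.comp continuous_snd)).sub ((hρc.comp continuous_fst).mul h1)
  set F' : T3 × V3 → ℝ := fun y => H' (y.1, ‖y.2 - u₀ y.1‖ ^ 2) *
      (∑ j, ∑ k, A y.1 j k * ((y.2 - u₀ y.1) j * (y.2 - u₀ y.1) k)) +
      (∑ j, b y.1 j * (y.2 - u₀ y.1) j) * G' (y.1, ‖y.2 - u₀ y.1‖ ^ 2) with hF'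
  have hF'c : Continuous F' := by rw [hF']; fun_prop
  have hF'F : ∀ y, F' y = χ (‖y.2 - u₀ y.1‖ ^ 2) * F y -
      ρ y.1 * (∑ j, b y.1 j * (y.2 - u₀ y.1) j) * (1 + |‖y.2 - u₀ y.1‖ ^ 2| / θ₀ y.1)⁻¹ := by
    intro y; simp only [hF', hH', hG']; rw [hF y]; ring
  have hF'def : ∀ y, F' y = H' (y.1, ‖y.2 - u₀ y.1‖ ^ 2) *
      (∑ j, ∑ k, A y.1 j k * ((y.2 - u₀ y.1) j * (y.2 - u₀ y.1) k)) +
      (∑ j, b y.1 j * (y.2 - u₀ y.1) j) * G' (y.1, ‖y.2 - u₀ y.1‖ ^ 2) := fun y => rfl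
  have hF'sh : ∀ x (ξ : V3), F' (x, u₀ x + Real.sqrt (θ₀ x) • ξ) =
      θ₀ x * (∑ j, ∑ k, A x j k * (ξ j * ξ k)) * χ (θ₀ x * ‖ξ‖ ^ 2) +
        Real.sqrt (θ₀ x) * (∑ j, b x j * ξ j) * G' (x, θ₀ x * ‖ξ‖ ^ 2) := by
    intro x ξ
    have h := classForm_shift (Real.mul_self_sqrt (hθpos x).le) (u₀ x) (A x) (b x) χ
      (fun s => G' (x, s)) ξ
    simp only [hF', hH']; exact h
  clear_value F' H' G'
  set Y : T3 × V3 → ℝ := fun y => C * (1 + ‖y.2‖ ^ 2) * (1 - χ (‖y.2 - u₀ y.1‖ ^ 2)) + δ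
    with hY
  clear_value Y
  -- bounds on `F'`
  have hF'B : ∀ y, |F' y| ≤ C * (1 + (2 * U ^ 2 + 4 * L)) + δ := by
    intro y
    rw [hF'F]
    refine (abs_sub _ _).trans (add_le_add ?_ (hcorr y.1 _))
    by_cases hw : ‖y.2 - u₀ y.1‖ ^ 2 ≤ 2 * L
    · rw [abs_mul, abs_of_nonneg (hχ0 _)]
      refine (mul_le_mul (hχ1 _) (hC y) (abs_nonneg _) zero_le_one).trans ?_
      rw [one_mul]; refine mul_le_mul_of_nonneg_left ?_ hC0
      have h1 : ‖y.2‖ ≤ ‖u₀ y.1‖ + ‖y.2 - u₀ y.1‖ := by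
        have := norm_add_le (u₀ y.1) (y.2 - u₀ y.1); rwa [add_sub_cancel] at this
      have h2 : ‖y.2‖ ^ 2 ≤ (‖u₀ y.1‖ + ‖y.2 - u₀ y.1‖) ^ 2 :=
        pow_le_pow_left₀ (norm_nonneg _) h1 2
      have h3 : ‖u₀ y.1‖ ^ 2 ≤ U ^ 2 := pow_le_pow_left₀ (norm_nonneg _) (hU y.1) 2
      have h4 : (‖u₀ y.1‖ + ‖y.2 - u₀ y.1‖) ^ 2 ≤
          2 * ‖u₀ y.1‖ ^ 2 + 2 * ‖y.2 - u₀ y.1‖ ^ 2 := by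
        nlinarith [sq_nonneg (‖u₀ y.1‖ - ‖y.2 - u₀ y.1‖)]
      linarith
    · rw [hχhi _ (not_le.1 hw).le, zero_mul, abs_zero]; positivity
  have hF'C : ∀ y, |F' y| ≤ (C + 3 * (K * θM * I₆) / m₀) * (1 + ‖y.2‖ ^ 2) := by
    intro y
    rw [hF'F]
    have hχF : |χ (‖y.2 - u₀ y.1‖ ^ 2) * F y| ≤ C * (1 + ‖y.2‖ ^ 2) := by
      rw [abs_mul, abs_of_nonneg (hχ0 _)]
      exact (mul_le_mul (hχ1 _) (hC y) (abs_nonneg _) zero_le_one).trans (le_of_eq (one_mul _))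
    have hδle : δ ≤ 3 * (K * θM * I₆) / m₀ := by
      have h1 : K * θM * I₆ / L ≤ K * θM * I₆ := div_le_self (by positivity) hL1
      calc δ = 3 * (K * θM * I₆ / L / m₀) := by rw [hδ, he]
        _ ≤ 3 * (K * θM * I₆ / m₀) := by gcongr
        _ = 3 * (K * θM * I₆) / m₀ := by ring
    calc _ ≤ C * (1 + ‖y.2‖ ^ 2) + δ := (abs_sub _ _).trans (add_le_add hχF (hcorr y.1 _))
      _ ≤ C * (1 + ‖y.2‖ ^ 2) + 3 * (K * θM * I₆) / m₀ * (1 + ‖y.2‖ ^ 2) := by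
          gcongr
          exact hδle.trans (le_mul_of_one_le_right (by positivity) (by nlinarith [sq_nonneg ‖y.2‖]))
      _ = (C + 3 * (K * θM * I₆) / m₀) * (1 + ‖y.2‖ ^ 2) := by ring
  /- Step 5: orthogonality of `F'` (reduced variable, then back to `v`). -/
  have hRG : ∀ x, ∫ ξ : V3, ξ 0 * ξ 0 * G' (x, θ₀ x * ‖ξ‖ ^ 2) ∂stdGaussian V3 = 0 := by
    intro x
    have hG'sh : ∀ ξ : V3, ξ 0 * ξ 0 * G' (x, θ₀ x * ‖ξ‖ ^ 2) =
        ξ 0 * ξ 0 * (G (x, θ₀ x * ‖ξ‖ ^ 2) * χ (θ₀ x * ‖ξ‖ ^ 2)) -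
          ρ x * (ξ 0 * ξ 0 * (1 + |‖ξ‖ ^ 2|)⁻¹) := by
      intro ξ; simp only [hG']
      rw [abs_mul, abs_of_pos (hθpos x), mul_div_cancel_left₀ _ (hθpos x).ne']; ring
    have hi1 : Integrable (fun ξ : V3 => ξ 0 * ξ 0 * (G (x, θ₀ x * ‖ξ‖ ^ 2) * χ (θ₀ x * ‖ξ‖ ^ 2)))
        (stdGaussian V3) :=
      integrable_coord_mul_weight 0 0 (ω := fun s => G (x, θ₀ x * s) * χ (θ₀ x * s))
        (by fun_prop) (P := GM)
        (fun s hs => le_mul_one_add (hGχ x _ (mul_nonneg (hθpos x).le hs)) hGM0 hs)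
    have hi2 : Integrable (fun ξ : V3 => ξ 0 * ξ 0 * (1 + |‖ξ‖ ^ 2|)⁻¹) (stdGaussian V3) :=
      integrable_coord_mul_weight 0 0 continuous_refWeight abs_refWeight_le
    simp_rw [hG'sh]
    rw [integral_sub hi1 (hi2.const_mul _), integral_const_mul, ← hm₀def, hρ,
      div_mul_cancel₀ _ hm₀.ne', sub_eq_zero, hR]
  have hF'red : ∀ x, (∫ ξ, F' (x, u₀ x + Real.sqrt (θ₀ x) • ξ) ∂stdGaussian V3 = 0) ∧
      (∀ j, ∫ ξ, F' (x, u₀ x + Real.sqrt (θ₀ x) • ξ) * ξ j ∂stdGaussian V3 = 0) ∧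
      ∫ ξ, F' (x, u₀ x + Real.sqrt (θ₀ x) • ξ) * ‖ξ‖ ^ 2 ∂stdGaussian V3 = 0 := by
    intro x
    have hlam : ∀ s, 0 ≤ s → |G' (x, θ₀ x * s)| ≤ (GM + |ρ x|) * (1 + s) := by
      intro s hs
      refine le_mul_one_add ?_ (by positivity) hs
      simp only [hG']
      refine (abs_sub _ _).trans (add_le_add (hGχ x _ (mul_nonneg (hθpos x).le hs)) ?_)
      rw [abs_mul]
      refine (mul_le_mul_of_nonneg_left ?_ (abs_nonneg _)).trans (le_of_eq (mul_one _))
      rw [abs_of_nonneg (inv_nonneg.2 (by have := hθpos x; positivity))]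
      exact inv_le_one_of_one_le₀ (le_add_of_nonneg_right (by have := hθpos x; positivity))
    exact truncated_gauss_orth (htr x) (χ := fun s => χ (θ₀ x * s))
      (lam := fun s => G' (x, θ₀ x * s)) (by fun_prop) (fun s => hχ0 _) (fun s => hχ1 _)
      (by fun_prop) hlam (hRG x) (f := fun ξ => F' (x, u₀ x + Real.sqrt (θ₀ x) • ξ))
      (by fun_prop) (fun ξ => hF'B _) (hF'sh x)
  have hF'orth : ∀ x, (∫ v, F' (x, v) * localMaxwellian 1 (θ₀ x) (u₀ x) v = 0) ∧
      (∀ j, ∫ v, F' (x, v) * v j * localMaxwellian 1 (θ₀ x) (u₀ x) v = 0) ∧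
      ∫ v, F' (x, v) * ‖v‖ ^ 2 * localMaxwellian 1 (θ₀ x) (u₀ x) v = 0 := fun x =>
    maxwellian_orth_of_gauss_orth (Φ := fun v => F' (x, v)) (by fun_prop) (hθpos x) (u₀ x)
      (fun v => hF'B (x, v)) (hF'red x).1 (hF'red x).2.1 (hF'red x).2.2
  /- Step 6: assembly. -/
  refine ⟨H', G', hH'c, hG'c, F', Y, hF'def, by rw [hY]; fun_prop,
    fun y => by rw [hY]; exact add_nonneg (mul_nonneg (by positivity) (sub_nonneg.2 (hχ1 _))) hδ0,
    ⟨_, hF'B⟩,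
    hF'C, fun x => (hF'orth x).1, fun x j => (hF'orth x).2.1 j, fun x => (hF'orth x).2.2,
    fun y => ?_, fun x => ?_⟩
  · -- the remainder `F - F' = (1 - χ)F + ρ (b·w)(1 + |w|²/θ)⁻¹` is dominated by `Y`
    rw [hF'F, hY]
    have e1 : F y - (χ (‖y.2 - u₀ y.1‖ ^ 2) * F y -
        ρ y.1 * (∑ j, b y.1 j * (y.2 - u₀ y.1) j) * (1 + |‖y.2 - u₀ y.1‖ ^ 2| / θ₀ y.1)⁻¹) =
        (1 - χ (‖y.2 - u₀ y.1‖ ^ 2)) * F y +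
          ρ y.1 * (∑ j, b y.1 j * (y.2 - u₀ y.1) j) * (1 + |‖y.2 - u₀ y.1‖ ^ 2| / θ₀ y.1)⁻¹ := by
      ring
    rw [e1]
    refine (abs_add_le _ _).trans (add_le_add ?_ (hcorr y.1 _))
    rw [abs_mul, abs_of_nonneg (sub_nonneg.2 (hχ1 _))]
    calc (1 - χ (‖y.2 - u₀ y.1‖ ^ 2)) * |F y|
        ≤ (1 - χ (‖y.2 - u₀ y.1‖ ^ 2)) * (C * (1 + ‖y.2‖ ^ 2)) :=
          mul_le_mul_of_nonneg_left (hC y) (sub_nonneg.2 (hχ1 _))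
      _ = C * (1 + ‖y.2‖ ^ 2) * (1 - χ (‖y.2 - u₀ y.1‖ ^ 2)) := by ring
  · -- the exponential moment of `Y` under `M_x`, uniformly in `x`
    rw [lintegral_mul_localMaxwellian_shift (hθpos x) (u₀ x)
      (fun v => Real.exp (a / (K + 1) * Y (x, v)))]
    have hpt : ∀ ξ : V3, Real.exp (a / (K + 1) * Y (x, u₀ x + Real.sqrt (θ₀ x) • ξ)) ≤
        Real.exp (a / (K + 1) * δ) *
          (1 + θM / L * (Real.exp a / a * Real.exp (2 * a * ‖ξ‖ ^ 2))) := by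
      intro ξ
      have hYv : Y (x, u₀ x + Real.sqrt (θ₀ x) • ξ) =
          C * (1 + ‖u₀ x + Real.sqrt (θ₀ x) • ξ‖ ^ 2) * (1 - χ (θ₀ x * ‖ξ‖ ^ 2)) + δ := by
        simp only [hY, add_sub_cancel_left, norm_smul, mul_pow, Real.norm_eq_abs, sq_abs,
          Real.sq_sqrt (hθpos x).le]
      rw [hYv]
      refine exp_tail_bound ha hK0 (hCK x ξ) (sq_nonneg _) (sub_nonneg.2 (hχ1 _))
        (by linarith [hχ0 (θ₀ x * ‖ξ‖ ^ 2)]) ?_ (by positivity)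
      calc 1 - χ (θ₀ x * ‖ξ‖ ^ 2) ≤ 1 / L * (θ₀ x * ‖ξ‖ ^ 2) :=
            hχtail _ (mul_nonneg (hθpos x).le (sq_nonneg _))
        _ ≤ 1 / L * (θM * ‖ξ‖ ^ 2) := by gcongr; exact hθM x
        _ = θM / L * ‖ξ‖ ^ 2 := by ring
    have hPint : Integrable (fun ξ : V3 => Real.exp (a / (K + 1) * δ) *
        (1 + θM / L * (Real.exp a / a * Real.exp (2 * a * ‖ξ‖ ^ 2)))) (stdGaussian V3) :=
      ((integrable_const _).add ((hexp.const_mul _).const_mul _)).const_mul _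
    calc ∫⁻ ξ, ENNReal.ofReal (Real.exp (a / (K + 1) * Y (x, u₀ x + Real.sqrt (θ₀ x) • ξ)))
          ∂stdGaussian V3
        ≤ ∫⁻ ξ, ENNReal.ofReal (Real.exp (a / (K + 1) * δ) *
            (1 + θM / L * (Real.exp a / a * Real.exp (2 * a * ‖ξ‖ ^ 2)))) ∂stdGaussian V3 :=
          lintegral_mono fun ξ => ENNReal.ofReal_le_ofReal (hpt ξ)
      _ = ENNReal.ofReal (∫ ξ, Real.exp (a / (K + 1) * δ) *
            (1 + θM / L * (Real.exp a / a * Real.exp (2 * a * ‖ξ‖ ^ 2))) ∂stdGaussian V3) :=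
          (ofReal_integral_eq_lintegral_ofReal hPint (ae_of_all _ fun ξ => by positivity)).symm
      _ ≤ ENNReal.ofReal (Real.exp η) := ENNReal.ofReal_le_ofReal ?_
    rw [integral_const_mul, integral_add (integrable_const _) ((hexp.const_mul _).const_mul _),
      integral_const_mul, integral_const_mul]
    have h1 : ∫ _ : V3, (1 : ℝ) ∂stdGaussian V3 = 1 := by simp
    rw [h1, ← hIF]
    have hA : θM / L * (Real.exp a / a * IF) = Q₁ / L := by rw [hQ₁]; ring
    have hB : a / (K + 1) * δ = Q₂ / L := by rw [hQ₂, hδ, he]; ring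
    rw [hA, hB]
    calc Real.exp (Q₂ / L) * (1 + Q₁ / L) ≤ Real.exp (η / 2) * (1 + η / 2) := by gcongr
      _ ≤ Real.exp (η / 2) * Real.exp (η / 2) := by
          gcongr; linarith [Real.add_one_le_exp (η / 2)]
      _ = Real.exp η := by rw [← Real.exp_add]; ring_nf

end Summit.AtomisticToContinuum.HydrodynamicLimit.Theorems.KineticCurrentsWindowLDUniformSketch

end
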